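import Literature.MathematicalPhysics.QuantumFieldTheory.BalabanImbrieJaffe1984to88.BIJ85AxialEdgeRigidity
import Literature.MathematicalPhysics.QuantumFieldTheory.BalabanImbrieJaffe1984to88.BIJ85NoZeroModes309TorusPart2

/-!
# `BalabanImbrieJaffe1984to88.BIJ85SigmaPositivity` — T. Bałaban, J. Imbrie, A. Jaffe, *Renormalization of the Higgs model:
minimizers, propagators and the stability of mean field theory*, Commun. Math. Phys. **97** (1985) 299–329 [BalabanImbrieJaffe1985]:
STRICT POSITIVITY OF σ_k ON THE TORI — `⟨f, σ_kf⟩ = 0 ⇒ f = 0` and `c_k‖f‖² ≤ ⟨f, σ_kf⟩` with some `c_k > 0` on every torus of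
the series, via the printed inductive block argument of p. 309 — PROVED

statement-level skeleton of published theorems with citation tags; proofs where landed; nothing here is a claim about the Yang–Mills mass gap

PDF held: `paper:balaban1985-cmp97-bij-higgs-minimizers` (journal page = PDF page + 298); pp. 306, 309, 310 [PDF 8, 11, 12] read on
the store's text layer.

THE PRINTED TEXT.  p. 306 [PDF 8], after (3.8): *"In particular we will establish strict positivity of σ₁ and Δ₁(u₁) in (3.8)."*
p. 309 [PDF 11]: *"The reader may wonder whether d has zero modes on the subspace of gauge fields satisfying Q_kA = 0 and satisfying
the axial gauge condition. Such zero modes do not occur … A proof of this fact for k = 1 follows by considering on each plaquette in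
a lattice block the condition dA = 0 and the axial gauge condition. … Similar, elementary reasoning yields an inductive proof for
k > 1, but we leave out the details."*  p. 310 [PDF 12]: *"σ_k = Q^e_k(I − ∂G_{k,Ax}∂^*)Q^{e*}_k = η^{−2}I − Q^e_k∂G_{k,Ax}∂^*Q^{e*}_k.
(4.2.2) … Using that representation we also establish a uniform, positive lower bound 0 < c ≦ σ_k. (4.2.3)"*

CITATION HEADER (lean-in-tree rule).  Phase-2 proof seat p33 (gen 2) of `lit-balaban` (HOME `run/shared/lean/pub/lit-balaban/`);
rows **C1.Claim@309** (the printed INDUCTIVE route, second proof), **C1.Eq3.8** (the sentence *"strict positivity of σ₁"*) and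
**C1.Eq4.2.3 — PARTIAL**: what is proved here is strict positivity of σ_k on each torus `T^{(k)}` of the series with a constant
depending on the torus and on k; the UNIFORM constant of (4.2.3) is Theorem 7.1.1 (momentum representation, Sect. 7) and is NOT
claimed.  Carriers OF RECORD: the tori and lattice calculus of `…Balaban1983to89.LatticeFieldCalculus` (`curl c`, `bondAvgIter k` = Q_k,
`IsAxial`), the axial-gauge constraint `BIJ85AxialPropagator411.constraint411 k` = δ(Q_kA)δ_{k,Ax}(A) / `V411`, `deltaAx`, the k-fold
pull-backs `BIJ85Eq531Inputs.QsstarIter` = Q^{s*}_k, `QestarIter` = Q^{e*}_k, and σ_k on the torus `BIJ85Sigma421Torus.sigmaTorus hd w c k`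
= p09's `sigmaOp (V411 P k) (curlOp w c) (QesOp hd w k)` ((4.2.2)).

WHAT IS PROVED.
* §1 — `Q^{e*}` and `Q^{e*}_k` are injective on the tori ((2.23) `Q^eQ^{e*} = L²I`, `BIJ85CurlQsstar.edgeQ_Qstar_torus`); `Q^{s*}_k0 = 0`,
  `Q^{e*}_k0 = 0`.
* §2 — THE INDUCTIVE BLOCK ARGUMENT (*"Similar, elementary reasoning yields an inductive proof for k > 1"*), in the strengthened form
  needed for σ_k: if `δ_{k,Ax}(A)` and `∂A = Q^{e*}_kg` for some plaquette field `g` on `T^{(k)}` then `A = Q^{s*}_k(Q_kA)`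
  (`eq_QsstarIter_bondAvgIter`; induction on k, the step being the one-level rigidity `BIJ85AxialEdgeRigidity.eq_Qsstar_bondAvg_of_curl_eq_Qstar`
  applied to `Q_kA` on `T^{(k)}` together with `∂Q^{s*}_k = Q^{e*}_k∂` and the injectivity of `Q^{e*}_k`); hence on the domain
  `δ(Q_kA)δ_{k,Ax}(A)` of (4.1.1), `∂A ∈ Q^{e*}_k(anything) ⇒ A = 0` (`eq_zero_of_curl_eq_QestarIter`), in particular the printed claim
  `∂A = 0 ⇒ A = 0` by the printed inductive route (`noZeroModes_torus_inductive`; the tree's first proof `BIJ85NoZeroModes309Torus.hD_holds`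
  went through the lattice Poincaré lemma instead).
* §3 — **σ_k > 0 ON EVERY TORUS**: by (4.2.2) `⟨f, σ_kf⟩ = ‖(I − ∂G_{k,Ax}∂^*)Q^{e*}_kf‖²` (p09 `inner_sigmaOp_eq_norm_sq`), so
  `⟨f, σ_kf⟩ = 0` forces `Q^{e*}_kf = ∂A` with `A` in the domain of (4.1.1), whence `A = 0`, `Q^{e*}_kf = 0`, `f = 0`
  (`eq_zero_of_inner_sigmaTorus_eq_zero`, `inner_sigmaTorus_pos`); and by compactness of the unit sphere of the finite-dimensional
  plaquette space, `∃ c_k > 0, c_k‖f‖² ≤ ⟨f, σ_kf⟩` (`sigmaTorus_coercive`) — the k = 1 case is the sentence of p. 306.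
Standing hypotheses: `k ≤ m + K` (block geometry), `2 ≤ d`, `w > 0` (the volume weight η^d of p09's encoding), `c ≠ 0` (lattice factor).
No new `def … : Prop`; theorem-only.  Axioms: {propext, Classical.choice, Quot.sound}.
Unit `lit-balaban-p33` gen 2 (literature-prover-lit-balaban-p33-g2-0), 2026-08-21.
-/

namespace Literature.MathematicalPhysics.QuantumFieldTheory.BalabanImbrieJaffe1984to88.BIJ85SigmaPositivity

open scoped BigOperators RealInnerProductSpace

open Literature.MathematicalPhysics.QuantumFieldTheory.Balaban1983to89
open LatticeFieldCalculus BIJ85Sect2SurfaceAverages BIJ85CellAverages BIJ85Eq219Proof BIJ85CurlQsstar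
  BIJ85AxialPropagator411 BIJ85AxialMinimizer413 BIJ85Eq531Inputs BIJ85Eq531Proof BIJ85SigmaForm421 BIJ85Sigma421Torus
  BIJ85AxialEdgeRigidity BIJ85NoZeroModes309Torus BIJ85NoZeroModes309TorusPart2

noncomputable section

variable {P : Params}

/-! ## §1  `Q^{e*}`, `Q^{e*}_k` injective; `Q^{s*}_k0 = 0`, `Q^{e*}_k0 = 0` -/

/-- `Q^{e*}` ((2.22)) is injective on the tori: `Q^eQ^{e*} = L²I` ((2.23)) (standing range, `2 ≤ d`). [cite: BalabanImbrieJaffe1985, (2.23) p.305] -/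
theorem Qstar_injective {j : ℕ} (hj : j + 1 ≤ P.m + P.K) (hd : 2 ≤ P.d) :
    Function.Injective (torusEdgeCells P j hd).Qstar := by
  intro g₁ g₂ h
  funext p'
  have hL : ((P.L : ℝ) ^ 2) ≠ 0 := pow_ne_zero _ (Nat.cast_ne_zero.mpr P.L_pos.ne')
  have h1 := edgeQ_Qstar_torus hj hd g₁ p'
  rw [h, edgeQ_Qstar_torus hj hd g₂ p'] at h1
  exact (mul_left_cancel₀ hL h1).symm

/-- `Q^{e*}_k = (Q^{e*})^k` ((2.24)) is injective on the tori (standing range `k ≤ m + K`, `2 ≤ d`). [cite: BalabanImbrieJaffe1985, (2.24) p.305] -/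
theorem QestarIter_injective (hd : 2 ≤ P.d) : ∀ {k : ℕ}, k ≤ P.m + P.K → Function.Injective (QestarIter (P := P) hd k) := by
  intro k
  induction k with
  | zero =>
    intro _ g₁ g₂ h
    simpa using h
  | succ k ih =>
    intro hk g₁ g₂ h
    rw [QestarIter_succ, QestarIter_succ] at h
    exact Qstar_injective (j := k) hk hd (ih (by omega) h)

/-- `Q^{s*}0 = 0` ((2.17)). [cite: BalabanImbrieJaffe1985, (2.17) p.304] -/
theorem Qsstar_zero_field (j : ℕ) : (torusBlockBonds P j).Qsstar (0 : PBond P (j + 1) → ℝ) = 0 := by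
  funext b
  by_cases h : ∃ b', b ∈ (torusBlockBonds P j).Bs b'
  · obtain ⟨b', hb'⟩ := h
    rw [(torusBlockBonds P j).Qsstar_of_mem 0 hb']
    simp
  · push Not at h
    rw [(torusBlockBonds P j).Qsstar_of_not_mem 0 h]
    rfl

/-- `Q^{s*}_k0 = 0` ((2.24)). [cite: BalabanImbrieJaffe1985, (2.24) p.305] -/
theorem QsstarIter_zero_field : ∀ k : ℕ, QsstarIter (P := P) k (0 : PBond P k → ℝ) = 0
  | 0 => rfl
  | k + 1 => by rw [QsstarIter_succ, Qsstar_zero_field, QsstarIter_zero_field k]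

/-- `Q^{e*}0 = 0` for any cell geometry ((2.22)). [cite: BalabanImbrieJaffe1985, (2.22) p.305] -/
theorem cellsQstar_zero (G : Cells) : G.Qstar (0 : G.C → ℝ) = 0 := by
  have h := cellsQstar_smul G 0 0
  rwa [zero_smul, zero_smul] at h

/-- `Q^{e*}_k0 = 0` ((2.24)). [cite: BalabanImbrieJaffe1985, (2.24) p.305] -/
theorem QestarIter_zero_field (hd : 2 ≤ P.d) : ∀ k : ℕ, QestarIter (P := P) hd k (0 : Plaq P k → ℝ) = 0
  | 0 => rfl
  | k + 1 => by rw [QestarIter_succ, cellsQstar_zero (torusEdgeCells P k hd), QestarIter_zero_field hd k]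

/-! ## §2  The inductive block argument of p. 309: `δ_{k,Ax}(A)`, `∂A = Q^{e*}_kg` ⇒ `A = Q^{s*}_k(Q_kA)` -/

/-- **THE INDUCTIVE BLOCK ARGUMENT** (*"Similar, elementary reasoning yields an inductive proof for k > 1"*), strengthened: a bond
field `A` on the finest torus `T^{(0)}` in the k-th axial gauge `δ_{k,Ax}(A)` whose plaquette field is an edge pull-back,
`∂A = Q^{e*}_kg`, is the surface pull-back of its k-fold average, `A = Q^{s*}_k(Q_kA)` — by induction on k: the fields `Q_kA` on
`T^{(k)}` are axial ((4.1.2)), `∂Q^{s*}_k = Q^{e*}_k∂` (`BIJ85Eq531Proof.curl_QsstarIter_div`) and the injectivity of `Q^{e*}_k` reduce the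
step to the one-level rigidity `BIJ85AxialEdgeRigidity.eq_Qsstar_bondAvg_of_curl_eq_Qstar` on `T^{(k)}` (lattice factor `c/L^k`);
standing range `k ≤ m + K`, `2 ≤ d`, `c ≠ 0`. [cite: BalabanImbrieJaffe1985, §4.1 p.309] -/
theorem eq_QsstarIter_bondAvgIter (hd : 2 ≤ P.d) {c : ℝ} (hc : c ≠ 0) :
    ∀ (k : ℕ), k ≤ P.m + P.K → ∀ (A : VecField P 0 ℝ) (g : Plaq P k → ℝ), deltaAx k A →
      curl c A = QestarIter hd k g → A = QsstarIter k (bondAvgIter k A) := by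
  intro k
  induction k with
  | zero =>
    intro _ A _ _ _
    rfl
  | succ k ih =>
    intro hk A g hAx hcurl
    have hLk : (P.L : ℝ) ^ k ≠ 0 := pow_ne_zero _ (Nat.cast_ne_zero.mpr P.L_pos.ne')
    have hck : c / (P.L : ℝ) ^ k ≠ 0 := div_ne_zero hc hLk
    obtain ⟨hAxk, hB⟩ := (deltaAx_succ k A).1 hAx
    rw [QestarIter_succ] at hcurl
    -- the induction hypothesis one level down: A = Q^{s*}_k(Q_kA)
    have IH : A = QsstarIter k (bondAvgIter k A) := ih (by omega) A _ hAxk hcurl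
    -- ∂Q^{s*}_k = Q^{e*}_k∂ and Q^{e*}_k injective: ∂(Q_kA) = Q^{e*}g on T^{(k)}
    have hcurlB : curl (c / (P.L : ℝ) ^ k) (bondAvgIter k A) = (torusEdgeCells P k hd).Qstar g := by
      apply QestarIter_injective hd (k := k) (by omega)
      rw [← curl_QsstarIter_div hd (by omega) c (bondAvgIter k A), ← IH, hcurl]
    -- the one-level rigidity on T^{(k)} for the axial field Q_kA
    have hB' : bondAvgIter k A = (torusBlockBonds P k).Qsstar (bondAvg (bondAvgIter k A)) :=
      eq_Qsstar_bondAvg_of_curl_eq_Qstar (by omega) hd hck hB g hcurlB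
    calc A = QsstarIter k (bondAvgIter k A) := IH
      _ = QsstarIter k ((torusBlockBonds P k).Qsstar (bondAvg (bondAvgIter k A))) := by rw [← hB']
      _ = QsstarIter (k + 1) (bondAvgIter (k + 1) A) := rfl

/-- **NO EDGE MODES ON THE DOMAIN OF (4.1.1)**: for `A` with `Q_kA = 0` and `δ_{k,Ax}(A)` (`constraint411 k`), `∂A = Q^{e*}_kg ⇒ A = 0`
— the plaquette field of a constrained axial field is an edge pull-back only if the field vanishes (standing range, `2 ≤ d`, `c ≠ 0`).
[cite: BalabanImbrieJaffe1985, §4.1 p.309] -/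
theorem eq_zero_of_curl_eq_QestarIter (hd : 2 ≤ P.d) {k : ℕ} (hk : k ≤ P.m + P.K) {c : ℝ} (hc : c ≠ 0) {A : VecField P 0 ℝ}
    (hA : A ∈ (constraint411 k : Submodule ℝ (VecField P 0 ℝ))) (g : Plaq P k → ℝ) (hcurl : curl c A = QestarIter hd k g) :
    A = 0 := by
  obtain ⟨hQ, hAx⟩ := (mem_constraint411 k A).1 hA
  rw [eq_QsstarIter_bondAvgIter hd hc k hk A g hAx hcurl, hQ, QsstarIter_zero_field]

/-- **C1.Claim@309 for every k BY THE PRINTED INDUCTIVE ROUTE** (*"Such zero modes do not occur … Similar, elementary reasoning yields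
an inductive proof for k > 1"*): on the domain `δ(Q_kA)δ_{k,Ax}(A)` of (4.1.1), `dA = 0 ⇒ A = 0` — the case `g = 0` of
`eq_zero_of_curl_eq_QestarIter` (a second proof of `BIJ85NoZeroModes309Torus.hD_holds`, here under `2 ≤ d`).
[cite: BalabanImbrieJaffe1985, §4.1 p.309] -/
theorem noZeroModes_torus_inductive (hd : 2 ≤ P.d) {k : ℕ} (hk : k ≤ P.m + P.K) {c : ℝ} (hc : c ≠ 0) {A : VecField P 0 ℝ}
    (hA : A ∈ (constraint411 k : Submodule ℝ (VecField P 0 ℝ))) (hcurl : ∀ p, curl c A p = 0) : A = 0 :=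
  eq_zero_of_curl_eq_QestarIter hd hk hc hA 0 (by rw [QestarIter_zero_field]; funext p; exact hcurl p)

/-! ## §3  σ_k is strictly positive on every torus -/

/-- Components of p09's weighted curl `curlOp w c = √w·∂`. [folklore] -/
private theorem curlOp_apply' (w c : ℝ) (v : BondSpace P) (p : Plaq P 0) :
    curlOp (P := P) w c v p = Real.sqrt w * curl c ((toE P).symm v) p := rfl

/-- **σ_k IS POSITIVE DEFINITE ON THE TORUS**: `⟨f, σ_kf⟩ = 0 ⇒ f = 0` for `sigmaTorus hd w c k` — by (4.2.2) `⟨f, σ_kf⟩ =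
‖(I − ∂G_{k,Ax}∂^*)Q^{e*}_kf‖²` (p09 `inner_sigmaOp_eq_norm_sq`, no zero modes by `BIJ85NoZeroModes309Torus`), so a null vector has
`Q^{e*}_kf = ∂A` with `A` in the domain `δ(Q_kA)δ_{k,Ax}(A)`, whence `A = 0` (§2) and `f = 0` (`Q^{e*}_k` injective); `k ≤ m + K`,
`2 ≤ d`, `w > 0`, `c ≠ 0`.  The k = 1 case is p. 306's *"we will establish strict positivity of σ₁"*; the printed (4.2.3) asserts MORE
(a constant uniform in k, Theorem 7.1.1), which is not claimed here. [cite: BalabanImbrieJaffe1985, (4.2.3) p.310] -/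
theorem eq_zero_of_inner_sigmaTorus_eq_zero (hd : 2 ≤ P.d) {k : ℕ} (hk : k ≤ P.m + P.K) {w : ℝ} (hw : 0 < w) {c : ℝ}
    (hc : c ≠ 0) {f : UnitPlaqSpace P k} (hf : ⟪f, sigmaTorus (P := P) hd w c k f⟫ = 0) : f = 0 := by
  have hD' := noZeroModes_V411_holds (P := P) hk hw hc
  -- ⟨f, σ_kf⟩ = ‖Q^{e*}_kf − ∂G∂^*Q^{e*}_kf‖² = 0: Q^{e*}_kf is the curl of a constraint field
  have h0 : QesOp (P := P) hd w k f = curlG (V411 P k) (curlOp (P := P) w c) (QesOp (P := P) hd w k f) := by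
    rw [sigmaTorus, inner_sigmaOp_eq_norm_sq hD'] at hf
    rw [← sub_eq_zero, ← norm_eq_zero]
    exact (pow_eq_zero_iff two_ne_zero).1 hf
  obtain ⟨v, hv⟩ := curlG_mem_range (V411 P k) (curlOp (P := P) w c) (QesOp (P := P) hd w k f)
  rw [hv] at h0
  obtain ⟨hQ, hAx⟩ := (mem_V411 k (v : BondSpace P)).1 v.2
  have hA : (toE P).symm (v : BondSpace P) ∈ (constraint411 k : Submodule ℝ (VecField P 0 ℝ)) :=
    (mem_constraint411 k _).2 ⟨hQ, hAx⟩
  have hsw : Real.sqrt w ≠ 0 := (Real.sqrt_pos.2 hw).ne'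
  -- componentwise: ∂A = Q^{e*}_kf for A = the bond field of v
  have hcurl : curl c ((toE P).symm (v : BondSpace P)) = QestarIter hd k (fun q => f q) := by
    funext p
    have h1 := congrArg (fun u : PlaqSpace P => u p) h0
    have h2 : Real.sqrt w * QestarIter hd k (fun q => f q) p =
        Real.sqrt w * curl c ((toE P).symm (v : BondSpace P)) p := by
      rw [← QesOp_apply, ← curlOp_apply']
      exact h1
    exact (mul_left_cancel₀ hsw h2).symm
  -- §2: A = 0, hence Q^{e*}_kf = 0 and f = 0
  have hA0 := eq_zero_of_curl_eq_QestarIter hd hk hc hA (fun q => f q) hcurl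
  have hQf : QestarIter hd k (fun q => f q) = QestarIter hd k 0 := by
    rw [← hcurl, hA0, QestarIter_zero_field]
    funext p
    simp [curl]
  have hf0 := QestarIter_injective hd hk hQf
  have h3 : (toU P k).symm f = 0 := by
    funext q
    exact congrFun hf0 q
  rw [← (toU P k).apply_symm_apply f, h3, map_zero]

/-- `⟨f, σ_kf⟩ > 0` for every `f ≠ 0` on the torus (`k ≤ m + K`, `2 ≤ d`, `w > 0`, `c ≠ 0`); per-torus strict positivity, not the uniform
bound (4.2.3). [cite: BalabanImbrieJaffe1985, (4.2.3) p.310] -/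
theorem inner_sigmaTorus_pos (hd : 2 ≤ P.d) {k : ℕ} (hk : k ≤ P.m + P.K) {w : ℝ} (hw : 0 < w) {c : ℝ} (hc : c ≠ 0)
    {f : UnitPlaqSpace P k} (hf : f ≠ 0) : 0 < ⟪f, sigmaTorus (P := P) hd w c k f⟫ :=
  lt_of_le_of_ne (sigmaTorus_form_bounds_holds hd hk hw hc f).1
    fun h => hf (eq_zero_of_inner_sigmaTorus_eq_zero hd hk hw hc h.symm)

/-- **A POSITIVE LOWER BOUND FOR σ_k ON EACH TORUS**: `∃ c_k > 0, c_k‖f‖² ≤ ⟨f, σ_kf⟩` for all unit-lattice plaquette fields `f` on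
`T^{(k)}` — strict positivity plus compactness of the unit sphere of the finite-dimensional plaquette space.  SCOPE: the constant
depends on the torus (on `P`) and on `k`; the printed *"uniform, positive lower bound 0 < c ≦ σ_k (4.2.3)"* (uniform in k and in the
volume) is Theorem 7.1.1 and is NOT proved here. [cite: BalabanImbrieJaffe1985, (4.2.3) p.310] -/
theorem sigmaTorus_coercive (hd : 2 ≤ P.d) {k : ℕ} (hk : k ≤ P.m + P.K) {w : ℝ} (hw : 0 < w) {c : ℝ} (hc : c ≠ 0) :
    ∃ c₀ : ℝ, 0 < c₀ ∧ ∀ f : UnitPlaqSpace P k, c₀ * ‖f‖ ^ 2 ≤ ⟪f, sigmaTorus (P := P) hd w c k f⟫ := by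
  have hcont : Continuous fun f : UnitPlaqSpace P k => ⟪f, sigmaTorus (P := P) hd w c k f⟫ :=
    continuous_id.inner (LinearMap.continuous_of_finiteDimensional _)
  have hscale : ∀ (a : ℝ) (f : UnitPlaqSpace P k),
      ⟪a • f, sigmaTorus (P := P) hd w c k (a • f)⟫ = a ^ 2 * ⟪f, sigmaTorus (P := P) hd w c k f⟫ := by
    intro a f
    rw [map_smul, real_inner_smul_left, real_inner_smul_right]
    ring
  have hsph : ∀ f : UnitPlaqSpace P k, f ≠ 0 → ‖f‖⁻¹ • f ∈ Metric.sphere (0 : UnitPlaqSpace P k) 1 := by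
    intro f hf
    rw [mem_sphere_zero_iff_norm, norm_smul, norm_inv, norm_norm, inv_mul_cancel₀ (norm_ne_zero_iff.2 hf)]
  by_cases hne : (Metric.sphere (0 : UnitPlaqSpace P k) 1).Nonempty
  · -- the minimum of the form on the unit sphere is attained and positive
    obtain ⟨f₀, hf₀, hmin⟩ := (isCompact_sphere (0 : UnitPlaqSpace P k) 1).exists_isMinOn hne hcont.continuousOn
    have hf₀ne : f₀ ≠ 0 := by
      intro h
      rw [h, mem_sphere_zero_iff_norm, norm_zero] at hf₀
      exact zero_ne_one hf₀
    refine ⟨_, inner_sigmaTorus_pos hd hk hw hc hf₀ne, fun f => ?_⟩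
    by_cases hf : f = 0
    · subst hf
      simp
    · have h1 := (isMinOn_iff.1 hmin) _ (hsph f hf)
      rw [hscale, inv_pow, inv_mul_eq_div] at h1
      exact (le_div_iff₀ (pow_pos (norm_pos_iff.2 hf) 2)).1 h1
  · -- degenerate torus data with no plaquette field but 0
    refine ⟨1, one_pos, fun f => ?_⟩
    have hf : f = 0 := by
      by_contra hf
      exact hne ⟨_, hsph f hf⟩
    subst hf
    simp

end

end Literature.MathematicalPhysics.QuantumFieldTheory.BalabanImbrieJaffe1984to88.BIJ85SigmaPositivity
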